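import Mathlib
import HarnessLib
import Literature.Analysis.FluidPDE.LeraySchemePressure
import Literature.Analysis.FluidPDE.LerayProfileCalculus
import Literature.Analysis.FluidPDE.TaoEnstrophyLocalisationProofs
import Literature.Analysis.FluidPDE.TypeIAncientMildClassical
import Summits.NavierStokesRegularity.NavierStokesRegularity.Theorems.PoloidalWindowDoorPoloidalWindowRigidityWindow

/-!
# K2 `PoloidalWindowRigidity` (stmt-NavierStokesRegularity-19708) — TSAI'S HEAD PRESSURE IN PHYSICAL VARIABLES:
# `(∂ₜ + v·∇ − Δ)[(−t)(½|v|² + p) + ½⟪x, v⟫] = −(−t)|curl v|² + S_p`, `S_p` = the pressure scaling defect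

Cell ns-regularity-ideate, seat nsreg-p7 gen 7 (third worker under the K2 lead ns-poloidal-K2-p1).  Whole-class,
(M)-consuming identity aimed at the stratum the residue S2⁗ is converging to (refuter1 K-30/K-31: after the thin-energy
clause (ix) and the time-derivative class rate (T), the (M)-free designs left are DSS-MODULATED packets; the open
classical wall on that side is the DSS Liouville problem).  Tsai 1998 §5 kills the SELF-SIMILAR stratum with the
head pressure `Π = ½|V|² + P + ½ y·V`, an `L`-subsolution in similarity variables; written back in physical variables
for an ARBITRARY classical solution, the same functional

  `π(t,x) := (−t)(½|v|² + p) + ½⟪x, v⟫`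

obeys the exact balance

  `∂ₜπ + Dπ(v) − Δπ = −(−t)|curl v|² + S_p`,   `S_p := (−t)∂ₜp − p − ½ Dp(x)`,

where `S_p = −½ (d/dλ)|_{λ=1} [λ² p(λ²t, λx)]` is the SCALING DEFECT of the pressure (`= (−t)⁻¹ ∂_σP` in similarity
variables `P(y,σ) = (−t)p`, `y = x/√(−t)`, `σ = −log(−t)`): it vanishes identically exactly for scale-invariant
pressures (Tsai's case) and has zero mean over a period in `σ` for discretely self-similar ones.  So `π` is a
sub-solution of the drift–heat operator wherever `S_p ≤ 0`, with dissipation `(−t)|ω|²` — the precise obstruction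
term for extending Tsai's maximum principle off the self-similar stratum («whether the Bernoulli head pressure
satisfies a maximum principle … was a key obstruction in previous works», Pineau–Vicol 2026, arXiv:2607.09619 p. 1),
now kernel-grade.  [cite: Tsai1998, §5 (p. 48)] [cite: PineauVicol2026, §1 p. 1]

* `tsai_identity` — the identity for every classical Navier–Stokes solution (unit viscosity, zero force) on an OPEN
  time set (`timeDerivWithin` = one-sided time derivative within the set).  Inputs: the momentum equation dotted with
  `v` and with `x`, the pressure Poisson equation `Δp = −tr((Dv)²)` (tree `laplacian_pressure_eq_of_isClassicalNSSolutionOn`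
  + `divergence_convect_self_eq`), `|Dv|²_F = |curl v|² + tr((Dv)²)` (tree `frobeniusNormSq_fderiv_eq_sq_norm_curl_add_trace`),
  `Δ|v|² = 2⟪Δv,v⟫ + 2|Dv|²_F`, `Δ⟪x,v⟫ = ⟪x,Δv⟫ + 2 div v`.
* `tsai_subsolution_of_scalingDefect_nonpos` — where `S_p ≤ 0`: `∂ₜπ + Dπ(v) − Δπ ≤ −(−t)|curl v|² ≤ 0`.
* `tsai_identity_of_class` — the same for a profile of the route's Type-I class with the classical pressure the tree
  provides on a window `(t₀, 0)` (two-sided `deriv` in time).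

WHAT THIS IS NOT: not a claim about Navier–Stokes regularity and not the crux — an exact identity (no Liouville theorem
is claimed off the self-similar stratum); bears_on LADDER-NS N0, route PoloidalWindowDoor, crux K2 (`--supports` it).
-/

noncomputable section

-- the summit and its single sub-problem share the name (CONVENTIONS §1), as in every Theorems file
set_option linter.dupNamespace false

namespace Summit.NavierStokesRegularity.NavierStokesRegularity.Theorems.PoloidalWindowDoorPoloidalWindowRigidityScalingDefect

open MeasureTheory Set Function Filter Topology Metric InnerProductSpace
open scoped RealInnerProductSpace Laplacian
open Literature.Analysis Literature.Analysis.FluidPDE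
open Summit.NavierStokesRegularity.NavierStokesRegularity.Theorems.PoloidalWindowDoorPoloidalWindowRigidityWindow

variable {S : Set ℝ} {v : ℝ → EuclideanSpace ℝ (Fin 3) → EuclideanSpace ℝ (Fin 3)}
  {p : ℝ → EuclideanSpace ℝ (Fin 3) → ℝ}

/-- **TSAI'S HEAD PRESSURE IN PHYSICAL VARIABLES.**  For a classical Navier–Stokes solution `(v, p)` (unit viscosity,
zero force) on an open time set `S`, the functional `π(τ,y) = (−τ)(½⟪v,v⟫ + p) + ½⟪y, v⟫` satisfies, at every `t ∈ S`
and every `x`,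
`∂ₜπ + Dπ(x)(v) − Δπ = −(−t)‖curl v(t,x)‖² + ((−t)∂ₜp − p − ½ Dp(x)(x))`. -/
theorem tsai_identity (hSo : IsOpen S) (hns : IsClassicalNSSolutionOn S 1 0 v p) {t : ℝ} (ht : t ∈ S)
    (x : EuclideanSpace ℝ (Fin 3)) :
    timeDerivWithin S (fun τ y => (-τ) * (2⁻¹ * ⟪v τ y, v τ y⟫ + p τ y) + 2⁻¹ * ⟪y, v τ y⟫) t x +
        fderiv ℝ (fun y => (-t) * (2⁻¹ * ⟪v t y, v t y⟫ + p t y) + 2⁻¹ * ⟪y, v t y⟫) x (v t x) -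
        (Δ (fun y => (-t) * (2⁻¹ * ⟪v t y, v t y⟫ + p t y) + 2⁻¹ * ⟪y, v t y⟫)) x =
      -(-t) * ‖curl (v t) x‖ ^ 2 +
        ((-t) * timeDerivWithin S p t x - p t x - 2⁻¹ * fderiv ℝ (p t) x x) := by
  have hS : UniqueDiffOn ℝ S := hSo.uniqueDiffOn
  -- regularity of the slices
  have hv2 : ContDiff ℝ 2 (v t) := (hns.contDiff_velocity ht).of_le (by norm_cast)
  have hp2 : ContDiff ℝ 2 (p t) := (hns.contDiff_pressure ht).of_le (by norm_cast)
  have hvd : ∀ y, DifferentiableAt ℝ (v t) y := fun y => (hv2.differentiable (by norm_num)) y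
  have hpd : ∀ y, DifferentiableAt ℝ (p t) y := fun y => (hp2.differentiable (by norm_num)) y
  -- ### (T) the time derivative
  have hv' : HasDerivWithinAt (fun τ => v τ x) (timeDerivWithin S v t x) S t := by
    rw [timeDerivWithin_apply]
    exact (hns.smooth_velocity.differentiableWithinAt_time ht x).hasDerivWithinAt
  have hp' : HasDerivWithinAt (fun τ => p τ x) (timeDerivWithin S p t x) S t := by
    rw [timeDerivWithin_apply]
    exact (hns.smooth_pressure.differentiableWithinAt_time ht x).hasDerivWithinAt
  have hvv := hv'.inner ℝ hv'
  have hH : HasDerivWithinAt (fun τ => 2⁻¹ * ⟪v τ x, v τ x⟫ + p τ x)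
      (2⁻¹ * (⟪v t x, timeDerivWithin S v t x⟫ + ⟪timeDerivWithin S v t x, v t x⟫) + timeDerivWithin S p t x) S t :=
    (hvv.const_mul 2⁻¹).add hp'
  have hneg : HasDerivWithinAt (fun τ : ℝ => -τ) (-1) S t := (hasDerivWithinAt_id t S).neg
  have hπ' : HasDerivWithinAt (fun τ => (-τ) * (2⁻¹ * ⟪v τ x, v τ x⟫ + p τ x) + 2⁻¹ * ⟪x, v τ x⟫)
      ((-1) * (2⁻¹ * ⟪v t x, v t x⟫ + p t x) +
        (-t) * (2⁻¹ * (⟪v t x, timeDerivWithin S v t x⟫ + ⟪timeDerivWithin S v t x, v t x⟫) + timeDerivWithin S p t x) +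
        2⁻¹ * (⟪x, timeDerivWithin S v t x⟫ + ⟪(0 : EuclideanSpace ℝ (Fin 3)), v t x⟫)) S t :=
    (hneg.mul hH).add (((hasDerivWithinAt_const t S x).inner ℝ hv').const_mul 2⁻¹)
  have hT : timeDerivWithin S (fun τ y => (-τ) * (2⁻¹ * ⟪v τ y, v τ y⟫ + p τ y) + 2⁻¹ * ⟪y, v τ y⟫) t x =
      -(2⁻¹ * ⟪v t x, v t x⟫ + p t x) +
        (-t) * (⟪v t x, timeDerivWithin S v t x⟫ + timeDerivWithin S p t x) + 2⁻¹ * ⟪x, timeDerivWithin S v t x⟫ := by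
    rw [timeDerivWithin_apply, hπ'.derivWithin (hS t ht), real_inner_comm (v t x) (timeDerivWithin S v t x),
      inner_zero_left]
    ring
  -- ### (X) the transport term
  have hHd : DifferentiableAt ℝ (fun y => 2⁻¹ * ⟪v t y, v t y⟫ + p t y) x :=
    (((hvd x).inner ℝ (hvd x)).const_mul _).add (hpd x)
  have hId : DifferentiableAt ℝ (fun y => ⟪y, v t y⟫) x := differentiableAt_id.inner ℝ (hvd x)
  have hX : fderiv ℝ (fun y => (-t) * (2⁻¹ * ⟪v t y, v t y⟫ + p t y) + 2⁻¹ * ⟪y, v t y⟫) x (v t x) =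
      (-t) * (⟪v t x, fderiv ℝ (v t) x (v t x)⟫ + fderiv ℝ (p t) x (v t x)) +
        2⁻¹ * (⟪v t x, v t x⟫ + ⟪x, fderiv ℝ (v t) x (v t x)⟫) := by
    have hI : fderiv ℝ (fun y => ⟪y, v t y⟫) x (v t x) = ⟪x, fderiv ℝ (v t) x (v t x)⟫ + ⟪v t x, v t x⟫ := by
      rw [show (fun y => ⟪y, v t y⟫) = fun y => ⟪id y, v t y⟫ from rfl,
        fderiv_inner_apply ℝ differentiableAt_id (hvd x), fderiv_id]
      rfl
    have hVV : fderiv ℝ (fun y => ⟪v t y, v t y⟫) x (v t x) = 2 * ⟪v t x, fderiv ℝ (v t) x (v t x)⟫ := by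
      rw [fderiv_inner_apply ℝ (hvd x) (hvd x), real_inner_comm (v t x) (fderiv ℝ (v t) x (v t x)), two_mul]
    rw [fderiv_fun_add (hHd.const_mul _) (hId.const_mul _), fderiv_const_mul hHd, fderiv_const_mul hId,
      fderiv_fun_add (((hvd x).inner ℝ (hvd x)).const_mul _) (hpd x), fderiv_const_mul ((hvd x).inner ℝ (hvd x))]
    simp only [_root_.add_apply, _root_.FunLike.coe_smul, Pi.smul_apply, smul_eq_mul]
    rw [hI, hVV]
    ring
  -- ### (L) the Laplacian
  have hvv2 : ContDiff ℝ 2 (fun y => ⟪v t y, v t y⟫) := hv2.inner ℝ hv2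
  have hH2 : ContDiff ℝ 2 (fun y => 2⁻¹ * ⟪v t y, v t y⟫ + p t y) := (contDiff_const.mul hvv2).add hp2
  have hI2 : ContDiff ℝ 2 (fun y => ⟪y, v t y⟫) := contDiff_id.inner ℝ hv2
  have hL : (Δ (fun y => (-t) * (2⁻¹ * ⟪v t y, v t y⟫ + p t y) + 2⁻¹ * ⟪y, v t y⟫)) x =
      (-t) * (⟪(Δ (v t)) x, v t x⟫ + frobeniusNormSq (fderiv ℝ (v t) x) + (Δ (p t)) x) +
        2⁻¹ * (⟪x, (Δ (v t)) x⟫ + 2 * VectorCalculus.divergence (v t) x) := by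
    have e1 : (fun y => (-t) * (2⁻¹ * ⟪v t y, v t y⟫ + p t y) + 2⁻¹ * ⟪y, v t y⟫) =
        (fun y => (-t) * (2⁻¹ * ⟪v t y, v t y⟫ + p t y)) + fun y => 2⁻¹ * ⟪y, v t y⟫ := rfl
    rw [e1, ContDiffAt.laplacian_add ((contDiff_const.mul hH2).contDiffAt) ((contDiff_const.mul hI2).contDiffAt),
      show (fun y => (-t) * (2⁻¹ * ⟪v t y, v t y⟫ + p t y)) = (-t) • (fun y => 2⁻¹ * ⟪v t y, v t y⟫ + p t y) from rfl,
      show (fun y => 2⁻¹ * ⟪y, v t y⟫) = (2⁻¹ : ℝ) • (fun y => ⟪y, v t y⟫) from rfl,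
      InnerProductSpace.laplacian_smul _ hH2.contDiffAt, InnerProductSpace.laplacian_smul _ hI2.contDiffAt]
    have e2 : (fun y => 2⁻¹ * ⟪v t y, v t y⟫ + p t y) = ((2⁻¹ : ℝ) • fun y => ⟪v t y, v t y⟫) + p t := rfl
    have hsm : ContDiffAt ℝ 2 ((2⁻¹ : ℝ) • fun y => ⟪v t y, v t y⟫) x := (hvv2.const_smul (2⁻¹ : ℝ)).contDiffAt
    rw [e2, ContDiffAt.laplacian_add hsm hp2.contDiffAt,
      InnerProductSpace.laplacian_smul _ hvv2.contDiffAt, laplacian_inner_self_eq hv2 x, laplacian_inner_id_eq hv2 x]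
    simp only [smul_eq_mul]
    ring
  -- ### (M) the momentum equation dotted with `v t x` and with `x`
  have hmom := hns.momentum t ht x
  simp only [one_smul, Pi.zero_apply, add_zero] at hmom
  have hgrad : ∀ w : EuclideanSpace ℝ (Fin 3), ⟪w, gradient (p t) x⟫ = fderiv ℝ (p t) x w := fun w => by
    rw [real_inner_comm (gradient (p t) x) w, gradient, InnerProductSpace.toDual_symm_apply]
  have hMv : ⟪v t x, timeDerivWithin S v t x⟫ + ⟪v t x, fderiv ℝ (v t) x (v t x)⟫ =
      ⟪v t x, (Δ (v t)) x⟫ - fderiv ℝ (p t) x (v t x) := by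
    have h := congrArg (fun z => ⟪v t x, z⟫) hmom
    simp only [inner_add_right, inner_sub_right, convect] at h
    rw [hgrad] at h
    exact h
  have hMx : ⟪x, timeDerivWithin S v t x⟫ + ⟪x, fderiv ℝ (v t) x (v t x)⟫ =
      ⟪x, (Δ (v t)) x⟫ - fderiv ℝ (p t) x x := by
    have h := congrArg (fun z => ⟪x, z⟫) hmom
    simp only [inner_add_right, inner_sub_right, convect] at h
    rw [hgrad] at h
    exact h
  -- ### (P) pressure Poisson and the `div`–`curl` algebra: `|Dv|²_F + Δp = |curl v|²`
  have hdiv0 : VectorCalculus.divergence (v t) x = 0 := hns.divFree t ht x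
  have hP : frobeniusNormSq (fderiv ℝ (v t) x) + (Δ (p t)) x = ‖curl (v t) x‖ ^ 2 := by
    have hti : t ∈ interior S := by rwa [hSo.interior_eq]
    rw [laplacian_pressure_eq_of_isClassicalNSSolutionOn hns hti x,
      divergence_convect_self_eq hv2 (hns.divFree t ht) x, frobeniusNormSq_fderiv_eq_sq_norm_curl_add_trace]
    simp [VectorCalculus.divergence]
  have hc : ⟪(Δ (v t)) x, v t x⟫ = ⟪v t x, (Δ (v t)) x⟫ := real_inner_comm _ _
  rw [hT, hX, hL, hdiv0]
  linear_combination (-t) * hMv + 2⁻¹ * hMx - (-t) * hP + t * hc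

/-- **Sub-solution where the scaling defect is non-positive.**  In the situation of `tsai_identity`, at a point where
`S_p = (−t)∂ₜp − p − ½Dp(x)(x) ≤ 0`:  `∂ₜπ + Dπ(v) − Δπ ≤ −(−t)‖curl v‖²` (`≤ 0` for `t ≤ 0`). -/
theorem tsai_subsolution_of_scalingDefect_nonpos (hSo : IsOpen S) (hns : IsClassicalNSSolutionOn S 1 0 v p)
    {t : ℝ} (ht : t ∈ S) (x : EuclideanSpace ℝ (Fin 3))
    (hSp : (-t) * timeDerivWithin S p t x - p t x - 2⁻¹ * fderiv ℝ (p t) x x ≤ 0) :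
    timeDerivWithin S (fun τ y => (-τ) * (2⁻¹ * ⟪v τ y, v τ y⟫ + p τ y) + 2⁻¹ * ⟪y, v τ y⟫) t x +
        fderiv ℝ (fun y => (-t) * (2⁻¹ * ⟪v t y, v t y⟫ + p t y) + 2⁻¹ * ⟪y, v t y⟫) x (v t x) -
        (Δ (fun y => (-t) * (2⁻¹ * ⟪v t y, v t y⟫ + p t y) + 2⁻¹ * ⟪y, v t y⟫)) x ≤
      -(-t) * ‖curl (v t) x‖ ^ 2 := by
  rw [tsai_identity hSo hns ht x]
  linarith

/-! ### on the route's Type-I class -/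

variable {C : ℝ}

/-- **TSAI'S IDENTITY ON THE CLASS.**  A profile of the route's Type-I class (rate, continuity on the slab, Oseen-mild,
divergence-free) has, on every window `(t₀, 0)`, a classical pressure `q` (tree
`IsTypeIAncientMild.exists_isClassicalNSSolutionOn_Ioo`) for which `π = (−t)(½|v|² + q) + ½⟪x,v⟫` satisfies the exact
balance of `tsai_identity` with the TWO-SIDED time derivatives (`deriv`) — the window is open. -/
theorem tsai_identity_of_class (hrate : HasTypeITimeDecay C v)
    (hcont : ContinuousOn (uncurry v) (Iio (0 : ℝ) ×ˢ univ))
    (hmild : ∀ s t : ℝ, s < t → t < 0 → ∀ y,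
      v t y = UnboundedOperators.heatExtension (v s) (t - s) y - oseenDuhamel 1 s v v t y)
    (hdiv : ∀ t < 0, VectorCalculus.IsDivFree (v t)) {t₀ : ℝ} (ht₀ : t₀ < 0) :
    ∃ q : ℝ → EuclideanSpace ℝ (Fin 3) → ℝ, IsClassicalNSSolutionOn (Ioo t₀ 0) 1 0 v q ∧
      ∀ t ∈ Ioo t₀ 0, ∀ x : EuclideanSpace ℝ (Fin 3),
        deriv (fun τ => (-τ) * (2⁻¹ * ⟪v τ x, v τ x⟫ + q τ x) + 2⁻¹ * ⟪x, v τ x⟫) t +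
            fderiv ℝ (fun y => (-t) * (2⁻¹ * ⟪v t y, v t y⟫ + q t y) + 2⁻¹ * ⟪y, v t y⟫) x (v t x) -
            (Δ (fun y => (-t) * (2⁻¹ * ⟪v t y, v t y⟫ + q t y) + 2⁻¹ * ⟪y, v t y⟫)) x =
          -(-t) * ‖curl (v t) x‖ ^ 2 +
            ((-t) * deriv (fun τ => q τ x) t - q t x - 2⁻¹ * fderiv ℝ (q t) x x) := by
  obtain ⟨q, hcl⟩ := (isTypeIAncientMild_of_class hrate hcont hmild hdiv).exists_isClassicalNSSolutionOn_Ioo ht₀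
  refine ⟨q, hcl, fun t ht x => ?_⟩
  have h := tsai_identity isOpen_Ioo hcl ht x
  rw [timeDerivWithin_apply, timeDerivWithin_apply, derivWithin_of_isOpen isOpen_Ioo ht,
    derivWithin_of_isOpen isOpen_Ioo ht] at h
  exact h

end Summit.NavierStokesRegularity.NavierStokesRegularity.Theorems.PoloidalWindowDoorPoloidalWindowRigidityScalingDefect

end
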